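import Literature.NumberTheory.EllipticCurves.ModularCurve
import Literature.NumberTheory.EllipticCurves.VariableChangePointsMap
import Literature.NumberTheory.EllipticCurves.LFunctionSmulProofs
import Literature.NumberTheory.EllipticCurves.GlobalMinimalModelProofs
import Literature.NumberTheory.EllipticCurves.OpenImageMazurProofs
import Literature.NumberTheory.EllipticCurves.TwoTorsionGaloisActionProofs
import Literature.NumberTheory.EllipticCurves.SelmerCorankProofs
import Literature.NumberTheory.EllipticCurves.BSDSelmerSmithNoRationalTwoTorsionProofs
import Summits.BirchSwinnertonDyer.BirchSwinnertonDyer.Theorems.ManinLocalTwoThreeEvenManinKummerSquare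
import Mathlib.RingTheory.Polynomial.RationalRoot
import HarnessLib

/-!
# Model glue for the reducible residual of C2: transporting a modular parametrisation datum along an
# integral change of variables with `u = 1`, and the `a₁ = a₃ = 0` normal form at the additive prime `2`

Summit `BirchSwinnertonDyer`, route `ManinLocalTwoThree` (cell bsd-f2-manin), deciding crux C2 `ManinOddAtFour`
(stmt-BirchSwinnertonDyer-22967), line `kato_shift_two`, stub `Rb` (the `W[2]`-reducible residual).  The an
planner's certificate programme for `Rb` (MEMO-an §56; tree leaf
`Summits/BirchSwinnertonDyer/Rank1Residual/ManinAdditive/CuspidalKummerClass.lean`, rows E-an-48/50/53) is typed for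
globally minimal equations with `a₁ = a₃ = 0` and integer `a₂, a₄` (the Kummer-blindness predicate
`KummerBlindAtTwo a₂ a₄ e`), while the crux and its residual quantify over an ARBITRARY globally minimal `W` with a
datum `D : ModularParametrizationData W N`.  This file is the «model glue (a₁ = a₃ = 0)» an §56.6 asks of the lead:

* `exists_modularParametrizationData_smul_of_u_eq_one` — a datum `D` for `W` at level `N` yields a datum `D'` for
  `C • W` with the SAME newform, Manin constant, Néron period pair and degree, for every change of variables `C`
  over `ℚ` with `u = 1` (the substitution `x = x' + r`, `y = y' + s x' + t` fixes the invariant differential, so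
  `Λ_{C • W} = Λ_W` and `φ' = ι ∘ φ` with `ι : W(ℂ) ≃ (C • W)(ℂ)` the tree's `VariableChange.pointEquivBaseChange`);
  in particular the lattice clause `Λ_W = c·Λ_f` transports verbatim;
* `exists_smul_a₁_a₃_eq_zero_of_hasAdditiveReductionAt_two` — a globally minimal `W` ADDITIVE at `2` has `a₁, a₃`
  even (p2's `even_a₁_and_even_a₃_of_hasAdditiveReductionAt_two`, Kraus parities), so `C = (1, 0, −a₁/2, −a₃/2)` is
  integral and `C • W = [0, a₂ + x², 0, a₄ + 2xy, a₆ + y²]` (`a₁ = 2x`, `a₃ = 2y`) is again GLOBALLY MINIMAL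
  (integral `u = 1` changes preserve minimality at every place: tree `isMinimal_adicCompletion_smul`).

Both are folklore (Silverman AEC III.1 Table 3.1, VII.1.3); nothing about BSD or Manin's conjecture is proved here.
-/

set_option autoImplicit false
set_option linter.dupNamespace false

noncomputable section

open scoped Classical MatrixGroups ModularForm
open CongruenceSubgroup IsDedekindDomain NumberField
open WeierstrassCurve Literature.NumberTheory.EllipticCurves Literature.NumberTheory.EllipticCurves.ModularForms

namespace Summit.BirchSwinnertonDyer.BirchSwinnertonDyer.Theorems.ManinLocalTwoThree

/-! ### §1 Transport of a modular parametrisation datum along `C = (1, r, s, t)` -/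

section Transport

variable (W : WeierstrassCurve ℚ) [W.IsElliptic] {N : ℕ} [NeZero N]

/-- Two affine points with equal coordinates are equal (proof-irrelevance plumbing). [folklore] -/
private theorem point_some_eq_some {F : Type*} [Field F] {V : WeierstrassCurve F} {x y x' y' : F}
    (h : V.toAffine.Nonsingular x y) (h' : V.toAffine.Nonsingular x' y') (hx : x = x') (hy : y = y') :
    (Affine.Point.some x y h : V.toAffine.Point) = Affine.Point.some x' y' h' := by
  subst hx hy; rfl

/-- **Transport of a modular parametrisation datum along a change of variables with `u = 1`.**  For
`C = (1, r, s, t)` over `ℚ` the substitution fixes `c₄, c₆` and the invariant differential, so the Néron period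
pair, the newform (`L`-function is an isomorphism invariant), the Manin constant and the degree of `D` serve
`C • W` verbatim, with uniformisation `ι ∘ uniformize` (`ι = pointEquivBaseChange W C ℂ`):
`ι(℘ − b₂/12, (℘' − a₁x − a₃)/2) = (℘ − b₂'/12, (℘' − a₁'x' − a₃')/2)` since `b₂' = b₂ + 12r`,
`a₁' = a₁ + 2s`, `a₃' = a₃ + r a₁ + 2t` (Silverman AEC III.1 Table 3.1). [cite: SilvermanAEC2009, III.1 Table 3.1] -/
theorem exists_modularParametrizationData_smul_of_u_eq_one (D : ModularParametrizationData W N)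
    (C : VariableChange ℚ) (hu : C.u = 1) :
    ∃ D' : ModularParametrizationData (C • W) N,
      D'.f = D.f ∧ D'.c = D.c ∧ D'.L = D.L ∧ D'.deg = D.deg := by
  set ι := VariableChange.pointEquivBaseChange W C ℂ with hι
  -- coefficient bookkeeping (`u = 1`)
  have hCu : (C.map (algebraMap ℚ ℂ)).u = 1 := by
    simp [VariableChange.map, hu]
  have hCr : (C.map (algebraMap ℚ ℂ)).r = (C.r : ℂ) := rfl
  have hCs : (C.map (algebraMap ℚ ℂ)).s = (C.s : ℂ) := rfl
  have hCt : (C.map (algebraMap ℚ ℂ)).t = (C.t : ℂ) := rfl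
  have hb₂ : ((C • W).baseChange ℂ).b₂ = (W.baseChange ℂ).b₂ + 12 * (C.r : ℂ) := by
    simp only [WeierstrassCurve.baseChange, map_b₂, variableChange_b₂, hu, inv_one, Units.val_one, one_pow,
      one_mul, map_add, map_mul, map_ofNat]
    rfl
  have ha₁ : ((C • W).baseChange ℂ).a₁ = (W.baseChange ℂ).a₁ + 2 * (C.s : ℂ) := by
    simp only [WeierstrassCurve.baseChange, map_a₁, variableChange_a₁, hu, inv_one, Units.val_one, one_mul,
      map_add, map_mul, map_ofNat]
    rfl
  have ha₃ : ((C • W).baseChange ℂ).a₃ =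
      (W.baseChange ℂ).a₃ + (C.r : ℂ) * (W.baseChange ℂ).a₁ + 2 * (C.t : ℂ) := by
    simp only [WeierstrassCurve.baseChange, map_a₃, variableChange_a₃, hu, inv_one, Units.val_one, one_pow,
      one_mul, map_add, map_mul, map_ofNat]
    rfl
  have hc₄ : ((C • W).baseChange ℂ).c₄ = (W.baseChange ℂ).c₄ := by
    simp only [WeierstrassCurve.baseChange, map_c₄, variableChange_c₄, hu, inv_one, Units.val_one, one_pow,
      one_mul]
  have hc₆ : ((C • W).baseChange ℂ).c₆ = (W.baseChange ℂ).c₆ := by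
    simp only [WeierstrassCurve.baseChange, map_c₆, variableChange_c₆, hu, inv_one, Units.val_one, one_pow,
      one_mul]
  refine ⟨{ f := D.f
            isNewformOf := ⟨D.isNewformOf.1, fun n => by rw [LFunction_smul]; exact D.isNewformOf.2 n⟩
            L := D.L
            isNeronLattice := ⟨by rw [hc₄]; exact D.isNeronLattice.1, by rw [hc₆]; exact D.isNeronLattice.2⟩
            uniformize := ι.toAddMonoidHom.comp D.uniformize
            ker_uniformize := ?_
            uniformize_surjective := ι.surjective.comp D.uniformize_surjective
            uniformize_spec := ?_
            c := D.c
            smul_periodLattice_le := D.smul_periodLattice_le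
            deg := D.deg
            deg_pos := D.deg_pos
            deg_spec := ?_ }, rfl, rfl, rfl, rfl⟩
  · -- kernel
    ext w
    rw [← D.ker_uniformize]
    simp only [SetLike.mem_coe, AddMonoidHom.mem_ker, AddMonoidHom.coe_comp, Function.comp_apply,
      AddEquiv.coe_toAddMonoidHom, map_eq_zero_iff ι ι.injective]
  · -- explicit formula off the lattice
    intro z hz
    obtain ⟨h, hh⟩ := D.uniformize_spec z hz
    set x : ℂ := D.L.weierstrassP z - (W.baseChange ℂ).b₂ / 12 with hx_def
    set y : ℂ := (D.L.derivWeierstrassP z - (W.baseChange ℂ).a₁ * (D.L.weierstrassP z - (W.baseChange ℂ).b₂ / 12)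
      - (W.baseChange ℂ).a₃) / 2 with hy_def
    have hx : (C.map (algebraMap ℚ ℂ)).toX x = D.L.weierstrassP z - ((C • W).baseChange ℂ).b₂ / 12 := by
      rw [VariableChange.toX_def, hCu, hCr, hb₂, inv_one, Units.val_one, one_pow, one_mul, hx_def]
      ring
    have hy : (C.map (algebraMap ℚ ℂ)).toY x y =
        (D.L.derivWeierstrassP z - ((C • W).baseChange ℂ).a₁ *
          (D.L.weierstrassP z - ((C • W).baseChange ℂ).b₂ / 12) - ((C • W).baseChange ℂ).a₃) / 2 := by
      rw [VariableChange.toY_def, hCu, hCr, hCs, hCt, hb₂, ha₁, ha₃, inv_one, Units.val_one, one_pow, one_mul,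
        hy_def, hx_def]
      ring
    have hns : ((C • W).baseChange ℂ).toAffine.Nonsingular ((C.map (algebraMap ℚ ℂ)).toX x)
        ((C.map (algebraMap ℚ ℂ)).toY x y) :=
      (VariableChange.baseChange_smul_eq W C ℂ) ▸
        (VariableChange.nonsingular_iff (W.baseChange ℂ) (C.map (algebraMap ℚ ℂ)) x y).mpr h
    have hns' : ((C • W).baseChange ℂ).toAffine.Nonsingular
        (D.L.weierstrassP z - ((C • W).baseChange ℂ).b₂ / 12)
        ((D.L.derivWeierstrassP z - ((C • W).baseChange ℂ).a₁ *
          (D.L.weierstrassP z - ((C • W).baseChange ℂ).b₂ / 12) - ((C • W).baseChange ℂ).a₃) / 2) := by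
      rw [← hy, ← hx]; exact hns
    refine ⟨hns', ?_⟩
    change ι (D.uniformize z) = _
    rw [hh, hι, VariableChange.pointEquivBaseChange_some]
    exact point_some_eq_some _ _ hx hy
  · -- the fibre count is transported along `ι`
    refine (D.deg_spec.image ι).subset fun P hP => ⟨ι.symm P, ?_, ι.apply_symm_apply P⟩
    have key : ∀ w : ℂ, (ι.toAddMonoidHom.comp D.uniformize) w = P ↔ D.uniformize w = ι.symm P := fun w => by
      rw [AddMonoidHom.coe_comp, Function.comp_apply, AddEquiv.coe_toAddMonoidHom, AddEquiv.apply_eq_iff_symm_apply]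
    simp only [Set.mem_setOf_eq, key] at hP
    exact hP

end Transport

/-! ### §2 The `a₁ = a₃ = 0` normal form of a globally minimal equation additive at `2` -/

section NormalForm

variable (W : WeierstrassCurve ℚ) [W.IsElliptic] [W.IsGloballyMinimal]

/-- An integer has valuation `≤ 1` at every finite place of `ℚ` (plumbing). [folklore] -/
private theorem valuation_intCast_le_one (v : HeightOneSpectrum (𝓞 ℚ)) (n : ℤ) :
    v.valuation ℚ (n : ℚ) ≤ 1 := by
  have e : (n : ℚ) = algebraMap (𝓞 ℚ) ℚ (n : 𝓞 ℚ) := by simp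
  rw [e]
  exact HeightOneSpectrum.valuation_le_one v _

/-- **The `a₁ = a₃ = 0` normal form at the additive prime `2`.**  A globally minimal `W/ℚ` with ADDITIVE
reduction at `2` has `a₁ = 2x`, `a₃ = 2y` even (Kraus parities, p2's
`even_a₁_and_even_a₃_of_hasAdditiveReductionAt_two`); the integral change of variables `C = (1, 0, −x, −y)`
(`y ↦ y + x·x' + y`, completing the square) produces the INTEGER equation
`C • W = [0, a₂ + x a₁ − x², 0, a₄ + x a₃ + y a₁ − 2xy, a₆ + y a₃ − y²]` with `a₁ = a₃ = 0`, which is again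
GLOBALLY MINIMAL (an integral change with unit `u` preserves minimality at every place, tree
`isMinimal_adicCompletion_smul`). Silverman AEC III.1 Table 3.1, VII.1.3. [cite: SilvermanAEC2009, III.1 Table 3.1] -/
theorem exists_smul_eq_map_a₁_a₃_eq_zero_of_hasAdditiveReductionAt_two
    (ha : W.HasAdditiveReductionAt ((Rat.HeightOneSpectrum.primesEquiv (R := 𝓞 ℚ)).symm ⟨2, Nat.prime_two⟩)) :
    ∃ (C : VariableChange ℚ) (M : WeierstrassCurve ℤ), C.u = 1 ∧ C • W = M.map (Int.castRingHom ℚ) ∧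
      M.a₁ = 0 ∧ M.a₃ = 0 ∧ (C • W).IsGloballyMinimal := by
  set M₀ : WeierstrassCurve ℤ := integralModelInt W with hM₀
  have hWM : M₀.map (Int.castRingHom ℚ) = W := map_integralModelInt W
  obtain ⟨⟨x, hx⟩, ⟨y, hy⟩⟩ := even_a₁_and_even_a₃_of_hasAdditiveReductionAt_two W ha
  have hx' : M₀.a₁ = x + x := hx
  have hy' : M₀.a₃ = y + y := hy
  have h1 : W.a₁ = (M₀.a₁ : ℚ) := by rw [← hWM, map_a₁, eq_intCast]
  have h2 : W.a₂ = (M₀.a₂ : ℚ) := by rw [← hWM, map_a₂, eq_intCast]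
  have h3 : W.a₃ = (M₀.a₃ : ℚ) := by rw [← hWM, map_a₃, eq_intCast]
  have h4 : W.a₄ = (M₀.a₄ : ℚ) := by rw [← hWM, map_a₄, eq_intCast]
  have h6 : W.a₆ = (M₀.a₆ : ℚ) := by rw [← hWM, map_a₆, eq_intCast]
  let C : VariableChange ℚ := ⟨1, 0, -(x : ℚ), -(y : ℚ)⟩
  let M : WeierstrassCurve ℤ :=
    ⟨0, M₀.a₂ + x * M₀.a₁ - x ^ 2, 0, M₀.a₄ + x * M₀.a₃ + y * M₀.a₁ - 2 * x * y, M₀.a₆ + y * M₀.a₃ - y ^ 2⟩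
  have hCW : C • W = M.map (Int.castRingHom ℚ) := by
    ext
    · simp only [variableChange_a₁, map_a₁, eq_intCast, h1, hx', C, M]; push_cast; ring
    · simp only [variableChange_a₂, map_a₂, eq_intCast, h1, h2, C, M]; push_cast; ring
    · simp only [variableChange_a₃, map_a₃, eq_intCast, h1, h3, hy', C, M]; push_cast; ring
    · simp only [variableChange_a₄, map_a₄, eq_intCast, h1, h2, h3, h4, C, M]; push_cast; ring
    · simp only [variableChange_a₆, map_a₆, eq_intCast, h1, h2, h3, h4, h6, C, M]; push_cast; ring
  refine ⟨C, M, rfl, hCW, rfl, rfl, ?_⟩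
  refine ⟨?_, fun v => ?_⟩
  · rw [hCW]
    exact isIntegral_of_exists_lift (𝓞 ℚ) ⟨((M.a₁ : ℤ) : 𝓞 ℚ), by simp⟩ ⟨((M.a₂ : ℤ) : 𝓞 ℚ), by simp⟩
      ⟨((M.a₃ : ℤ) : 𝓞 ℚ), by simp⟩ ⟨((M.a₄ : ℤ) : 𝓞 ℚ), by simp⟩ ⟨((M.a₆ : ℤ) : 𝓞 ℚ), by simp⟩
  · refine isMinimal_adicCompletion_smul (IsGloballyMinimal.isMinimal v) C (by simp [C]) (by simp [C]) ?_ ?_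
    · simpa [C] using valuation_intCast_le_one v (-x)
    · simpa [C] using valuation_intCast_le_one v (-y)

end NormalForm

/-! ### §3 `W[2]` reducible ⟹ a rational (hence integral) `2`-torsion abscissa -/

section TwoTorsion

open Literature.NumberTheory.EllipticCurves.Mazur1978 Literature.NumberTheory.EllipticCurves.DokchitserDokchitser2012

/-- **A reducible `E[2]` has a `ℚ`-rational `2`-torsion abscissa.**  A `Γ_ℚ`-stable subgroup of `E[2]` of
order `2` (Mazur's dictionary, tree `not_hasIrreducibleModPGaloisRep_iff_exists_natCard_eq`) is `{O, Q}` with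
`σQ = Q` for all `σ` (`σQ ∈ {O, Q}`, `σQ ≠ O`), so `Q` descends to `E(ℚ)` (tree
`exists_toGeomPoints_eq_of_forall_smul_eq`) where it is a point `(e, y)` with `2(e, y) = O`, whence `e` is a root of
the `2`-division cubic `4x³ + b₂x² + 2b₄x + b₆` (tree `isRoot_twoTorsionPolynomial_of_add_self_eq_zero`).
Silverman AEC III.4.12 / VIII.§1 / Ex. 3.7. [cite: SilvermanAEC2009, Ex. III.3.7 (d)] -/
theorem exists_isRoot_twoTorsionPolynomial_of_not_hasIrreducibleModPGaloisRep_two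
    (V : WeierstrassCurve ℚ) [V.IsElliptic] (hred : ¬ V.HasIrreducibleModPGaloisRep 2) :
    ∃ e : ℚ, V.twoTorsionPolynomial.toPoly.IsRoot e := by
  obtain ⟨H, hH, hcard⟩ := (not_hasIrreducibleModPGaloisRep_iff_exists_natCard_eq V 2).mp hred
  obtain ⟨Q, hQ0, rfl⟩ := exists_eq_zmultiples_of_natCard_eq V 2 hcard
  have h2Q : (Q : geomPoints V) + Q = 0 := coe_add_self_eq_zero V Q
  have hQQ : Q + Q = 0 := Subtype.ext h2Q
  have hfix : ∀ σ : Field.absoluteGaloisGroup ℚ, σ • (Q : geomPoints V) = Q := by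
    intro σ
    have hmem : σ • Q ∈ AddSubgroup.zmultiples Q := hH σ Q (AddSubgroup.mem_zmultiples Q)
    obtain ⟨k, hk⟩ := AddSubgroup.mem_zmultiples_iff.mp hmem
    have hkQ : k • Q = 0 ∨ k • Q = Q := by
      rcases Int.even_or_odd k with ⟨m, rfl⟩ | ⟨m, rfl⟩
      · left
        rw [add_zsmul, ← smul_add, hQQ, smul_zero]
      · right
        rw [add_zsmul, one_zsmul, mul_comm, mul_smul, two_zsmul, hQQ, smul_zero, zero_add]
    have hne : σ • Q ≠ 0 := by rw [Ne, smul_eq_zero_iff_eq]; exact hQ0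
    rcases hkQ with h0 | h1
    · exact absurd (hk.symm.trans h0) hne
    · rw [← AddSubgroup.torsionBy.coe_smul, ← hk, h1]
  -- Galois descent: `Q` comes from `E(ℚ)`; its abscissa is a root of the `2`-division cubic
  obtain ⟨P, hP⟩ := exists_toGeomPoints_eq_of_forall_smul_eq V hfix
  set L := AlgebraicClosure ℚ with hL
  rcases P with _ | ⟨x, y, hxy⟩
  · exfalso
    apply hQ0
    apply Subtype.ext
    rw [← hP]
    rfl
  · have e' : ∃ h', (Q : geomPoints V) =
        Affine.Point.some (algebraMap ℚ L x) (algebraMap ℚ L y) h' := ⟨_, hP.symm⟩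
    obtain ⟨h', e'⟩ := e'
    rw [e'] at h2Q
    have hroot := ((V.baseChange L).isRoot_twoTorsionPolynomial_of_add_self_eq_zero h2Q).2
    rw [isRoot_twoTorsionPolynomial_iff] at hroot
    refine ⟨x, (isRoot_twoTorsionPolynomial_iff V x).mpr ?_⟩
    have e : 4 * (algebraMap ℚ L x) ^ 3 + (V.baseChange L).b₂ * (algebraMap ℚ L x) ^ 2 +
        2 * (V.baseChange L).b₄ * (algebraMap ℚ L x) + (V.baseChange L).b₆ =
        algebraMap ℚ L (4 * x ^ 3 + V.b₂ * x ^ 2 + 2 * V.b₄ * x + V.b₆) := by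
      simp only [baseChange, map_b₂, map_b₄, map_b₆, map_add, map_mul, map_pow, map_ofNat]
    rw [e, map_eq_zero_iff _ (algebraMap ℚ L).injective] at hroot
    exact hroot

/-- **On an integer equation with `a₁ = a₃ = 0` a rational `2`-torsion abscissa is an INTEGER**: the
`2`-division cubic is `4(x³ + a₂x² + a₄x + a₆)`, monic up to the unit-free factor `4`, so the rational root
theorem applies (Mathlib `isInteger_of_is_root_of_monic`). [folklore] -/
theorem exists_intCast_eq_of_isRoot_twoTorsionPolynomial (M : WeierstrassCurve ℤ) (h₁ : M.a₁ = 0)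
    (h₃ : M.a₃ = 0) {e : ℚ} (he : (M.map (Int.castRingHom ℚ)).twoTorsionPolynomial.toPoly.IsRoot e) :
    ∃ n : ℤ, (n : ℚ) = e := by
  have hcubic : e ^ 3 + M.a₂ * e ^ 2 + M.a₄ * e + M.a₆ = 0 := by
    simp only [twoTorsionPolynomial, Cubic.toPoly, Polynomial.IsRoot.def, Polynomial.eval_add,
      Polynomial.eval_mul, Polynomial.eval_C, Polynomial.eval_pow, Polynomial.eval_X, b₂, b₄, b₆, map_a₁,
      map_a₂, map_a₃, map_a₄, map_a₆, h₁, h₃, eq_intCast, Int.cast_zero] at he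
    linear_combination he / 4
  set p : Polynomial ℤ := (⟨1, M.a₂, M.a₄, M.a₆⟩ : Cubic ℤ).toPoly with hp_def
  have hp : p.Monic := Cubic.monic_of_a_eq_one rfl
  have hr : Polynomial.aeval e p = 0 := by
    simp only [hp_def, Cubic.toPoly, map_add, map_mul, map_pow, eq_intCast, map_intCast, Polynomial.aeval_X,
      Int.cast_one, one_mul]
    linear_combination hcubic
  obtain ⟨n, hn⟩ := isInteger_of_is_root_of_monic hp hr
  exact ⟨n, by simpa using hn⟩

end TwoTorsion

end Summit.BirchSwinnertonDyer.BirchSwinnertonDyer.Theorems.ManinLocalTwoThree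

end
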